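import Summits.NavierStokesRegularity.TurbBounds.ShearCutoff
import Summits.NavierStokesRegularity.TurbBounds.Certs.S50.Scalars

/-!
# Certificate S50 (CERTIFIED.md row R2-50: FW16 2-D stress-driven shear, Γx 2, Gr 50) — every mode beyond the cutoff is free

The scalar line `Certs.S50.Scalars.cutoff : Γx²·T ≤ 2π²·(m_cert + 1)²` (T = ‖φ̂‖₁ ≥ ‖dφ/dζ‖_∞, m_cert = 2) fed into
`ShearCutoff.modes_free_nat`: for every 2-D wavenumber `α_m = 2πm/Γx` with `m ≥ 3` one has `2T ≤ α_m²`, which is the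
hypothesis of `ShearCutoff.mode_free` (FW16 (2.18)) — so only the modes m = 1, 2 need LMI blocks (`Certs.S50.B001/B002`).
Pure instance file (pub-turb-shear gen 5). HONEST FRAMING: rigorous bounds for the stated PDE and boundary conditions; no claim
about physical turbulence beyond the bound.
-/

namespace Summit.NavierStokesRegularity.TurbBounds.Certs.S50

/-- **R2-50: all modes `m ≥ m_cert + 1 = 3` are free** (`2‖φ̂‖₁ ≤ α_m²`, the hypothesis of `ShearCutoff.mode_free`). -/
theorem modes_free {m : ℕ} (hm : Scalars.mCert + 1 ≤ m) :
    2 * (Scalars.T : ℝ) ≤ (2 * Real.pi * (m : ℝ) / (Scalars.Gx : ℝ)) ^ 2 :=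
  ShearCutoff.modes_free_nat (by norm_num [Scalars.Gx]) Scalars.cutoff hm

/-- In particular the first free mode is `m = 3`. -/
example : 2 * (Scalars.T : ℝ) ≤ (2 * Real.pi * (3 : ℕ) / (Scalars.Gx : ℝ)) ^ 2 :=
  modes_free (by decide)

end Summit.NavierStokesRegularity.TurbBounds.Certs.S50
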